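import Summits.CriticalPhenomena.CardyFormulaZ2.Theses.PivotalEnergyLaw
import Summits.CriticalPhenomena.CardyFormulaZ2.Theses.CardyUniqueLimit
import Literature.Probability.RandomPlanarGeometry.ImageUnivalent
import Literature.Analysis.Complex.InjectiveHolomorphic

/-!
# Redirect certificate for crux `ConformalDilationCovariance` (stmt-CriticalPhenomena-4705)

Crux-strategist r1 (REDIRECT, likely-fail scan 2026-08-17), route `PivotalEnergyLaw`
(route-CriticalPhenomena-PivotalEnergyLaw), sub-problem `CardyFormulaZ2`, summit `CriticalPhenomena`.

Write `S := CardyFormulaZ2` (the sub-problem Statement: every conformal rectangle has bond-`ℤ²`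
crossing limit `cardyFunction (crossRatio ·)`), `X := PivotalEnergyLaw.ConformalDilationCovariance`
(the route's thesis and rank-2 crux: along the Koebe blow-up path `s ↦ φ(p + s(D − p))` of a map `φ`
univalent near the closed disc `D̄`, read at mesh `sδ`, the crossing probabilities are asymptotically
independent of `s ∈ (0,1]`).

Two sorry-free theorems, both resting on ONE geometric lemma (`blowup_imageData`: the crux's
rectangle `R`, which presents the blow-up quad `φ(D_r)` with marks `φ(p + r(yᵢ − p))`, is IMAGE DATA
of the round marked disc `D = markedDisc c ρ θ` under the univalent map `h_r := φ ∘ A_r`,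
`A_r z = p + r(z − p)` — so all the `R`'s of the crux, for all `r`, are conformal images of one and the
same marked disc, with the SAME real boundary preimages `x` of the marks, hence the same cross-ratio):

* `conformalDilationCovariance_of_cardyFormulaZ2 : S → X` — **the crux is a CONSEQUENCE of the
  summit** (probe `S → C` succeeds by a real proof; the cheap battery does not find it): transfer the
  Cardy limit of `R` and of `R'` to the marked disc (`HasCrossingLimit.of_image_data`), evaluate both at
  one uniformizing datum of the disc (`exists_isUniformizing_holds`), read along `δ ↦ sδ`, `δ ↦ tδ`,
  subtract: `F η − F η = 0`.
* `conformalDilationCovariance_of_subs : LimitExists → ConfInvTransport → X` — **the typed split of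
  the crux into the two cruxes of route `CardyUniqueLimit`** (`LimitExists` = stmt-0747, already crux #5
  of `PivotalEnergyLaw`, stated here through `PivotalEnergyLaw.LimitExists`; `ConfInvTransport` =
  stmt-0794, `CardyUniqueLimit.ConfInvTransport`, conformal invariance of crossing limits in transport
  form): `LimitExists` gives a limit `L` for `R`; `R` and `R'` carry the transported uniformizing data
  `(h_s ∘ ψ, x)`, `(h_t ∘ ψ, x)` of the disc (`IsUniformizing.image_data`) with literally the same `x`,
  so `ConfInvTransport` moves `L` to `R'`; subtract as before.  This is Beffara's existence / symmetry
  cut (barrier `Literature.Barriers.CriticalPhenomena.EmbeddingModulusUniqueness`): `LimitExists` is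
  embedding-blind (existence-type) content, `ConfInvTransport` the conformal (symmetry) content under an
  existence hypothesis; `X` is the existence-free form of the symmetry content and sits below their
  conjunction (`LimitExists ∧ ConfInvTransport ⟺ CardyUniqueLimitThesis = X_U ⟹ X`).

`markedDisc`, `markedDisc_pt`, `closedBall_blowup_subset` and `tendsto_const_mul_nhdsWithin_zero` are
copied from the registered birth skeleton `Cruxes/ConformalDilationCovariance/Lines/birth.lean` (that
module carries the two `sorry` stubs and is therefore not imported).
-/

noncomputable section

namespace Summit.CriticalPhenomena.CardyFormulaZ2.Cruxes.ConformalDilationCovariance.Redirect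

open scoped Topology
open Set Filter
open Literature.Probability.RandomPlanarGeometry Literature.Probability.Percolation
open Summit.CriticalPhenomena.CardyFormulaZ2.Theses

/-! ### A round marked disc as a conformal rectangle (from `Lines/birth.lean`) -/

/-- The round disc `ball c ρ` marked at the four points `c + ρe^{iθᵢ}`, for angles
`θ 0 < θ 1 < θ 2 < θ 3 < θ 0 + 2π`: boundary loop `t ↦ c + ρe^{i(2πt + θ₀)}`, marks
`(θᵢ - θ₀)/(2π) ∈ [0,1)`. -/
def markedDisc (c : ℂ) (ρ : ℝ) (hρ : 0 < ρ) (θ : Fin 4 → ℝ) (hθ : StrictMono θ)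
    (hθ' : θ 3 < θ 0 + 2 * Real.pi) :
    Literature.Probability.RandomPlanarGeometry.ConformalRectangle where
  carrier := Metric.ball c ρ
  boundary u := circleMap c ρ (2 * Real.pi * u + θ 0)
  isOpen := Metric.isOpen_ball
  isBounded := Metric.isBounded_ball
  isConnected := ((convex_ball c ρ).isPathConnected (Metric.nonempty_ball.2 hρ)).isConnected
  continuous_boundary := (continuous_circleMap c ρ).comp (by fun_prop)
  periodic_boundary u := by
    simp only
    rw [show 2 * Real.pi * (u + 1) + θ 0 = 2 * Real.pi * u + θ 0 + 2 * Real.pi by ring]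
    exact periodic_circleMap c ρ _
  injOn_boundary := by
    intro u hu v hv h
    have hinj := injOn_circleMap_of_abs_sub_le' (c := c) (a := θ 0) (b := θ 0 + 2 * Real.pi)
      hρ.ne' (by linarith)
    have key : 2 * Real.pi * u + θ 0 = 2 * Real.pi * v + θ 0 :=
      hinj ⟨by nlinarith [Real.pi_pos, hu.1], by nlinarith [Real.pi_pos, hu.2]⟩
        ⟨by nlinarith [Real.pi_pos, hv.1], by nlinarith [Real.pi_pos, hv.2]⟩ h
    have : 2 * Real.pi * u = 2 * Real.pi * v := by linarith
    exact mul_left_cancel₀ (by positivity) this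
  range_boundary := by
    have hs : Function.Surjective fun u : ℝ ↦ 2 * Real.pi * u + θ 0 := fun y ↦
      ⟨(y - θ 0) / (2 * Real.pi), by field_simp; ring⟩
    rw [frontier_ball _ hρ.ne', show (fun u : ℝ ↦ circleMap c ρ (2 * Real.pi * u + θ 0)) =
      circleMap c ρ ∘ fun u : ℝ ↦ 2 * Real.pi * u + θ 0 from rfl, hs.range_comp, range_circleMap,
      abs_of_pos hρ]
  mark i := (θ i - θ 0) / (2 * Real.pi)
  strictMono_mark i j hij := div_lt_div_of_pos_right (by linarith [hθ hij]) (by positivity)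
  mark_mem i := by
    have h0 : θ 0 ≤ θ i := hθ.monotone (Fin.zero_le i)
    have h3 : θ i ≤ θ 3 := hθ.monotone (Fin.le_last i)
    constructor
    · exact div_nonneg (by linarith) (by positivity)
    · rw [div_lt_one (by positivity)]
      linarith

/-- The marked points of `markedDisc c ρ θ` are `c + ρ e^{iθᵢ}`. -/
theorem markedDisc_pt (c : ℂ) (ρ : ℝ) (hρ : 0 < ρ) (θ : Fin 4 → ℝ) (hθ : StrictMono θ)
    (hθ' : θ 3 < θ 0 + 2 * Real.pi) (i : Fin 4) :
    (markedDisc c ρ hρ θ hθ hθ').pt i = c + ρ * Complex.exp (Complex.I * θ i) := by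
  have h2 : 2 * Real.pi * ((θ i - θ 0) / (2 * Real.pi)) + θ 0 = θ i := by
    field_simp
    ring
  show circleMap c ρ (2 * Real.pi * ((θ i - θ 0) / (2 * Real.pi)) + θ 0) = _
  rw [h2]
  simp only [circleMap]
  rw [mul_comm Complex.I]

/-- The carrier of `markedDisc c ρ θ` is `ball c ρ` (definitional). -/
theorem markedDisc_carrier (c : ℂ) (ρ : ℝ) (hρ : 0 < ρ) (θ : Fin 4 → ℝ) (hθ : StrictMono θ)
    (hθ' : θ 3 < θ 0 + 2 * Real.pi) : (markedDisc c ρ hρ θ hθ hθ').carrier = Metric.ball c ρ := rfl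

/-! ### Elementary facts about the blow-up maps `A_r z = p + r (z - p)` -/

/-- `A_r` scales distances by `r`. -/
theorem dist_blowup (p z w : ℂ) {r : ℝ} (hr : 0 ≤ r) :
    dist (p + r * (z - p)) (p + r * (w - p)) = r * dist z w := by
  rw [dist_eq_norm, dist_eq_norm,
    show p + (r : ℂ) * (z - p) - (p + r * (w - p)) = (r : ℂ) * (z - w) by ring,
    norm_mul, Complex.norm_real, Real.norm_eq_abs, abs_of_nonneg hr]

/-- `A_r` maps the disc `ball c ρ` ONTO the blow-up disc `ball (p + r(c - p)) (rρ)`. -/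
theorem image_blowup_ball (p c : ℂ) {r : ℝ} (ρ : ℝ) (hr : 0 < r) :
    (fun z : ℂ => p + r * (z - p)) '' Metric.ball c ρ = Metric.ball (p + r * (c - p)) (r * ρ) := by
  have hr' : (r : ℂ) ≠ 0 := Complex.ofReal_ne_zero.2 hr.ne'
  ext w
  simp only [Set.mem_image, Metric.mem_ball]
  constructor
  · rintro ⟨z, hz, rfl⟩
    rw [dist_blowup p z c hr.le]
    exact mul_lt_mul_of_pos_left hz hr
  · intro hw
    refine ⟨p + (r : ℂ)⁻¹ * (w - p), ?_, ?_⟩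
    · have h1 : dist (p + (r : ℂ)⁻¹ * (w - p)) c = r⁻¹ * dist w (p + r * (c - p)) := by
        rw [dist_eq_norm, dist_eq_norm,
          show p + (r : ℂ)⁻¹ * (w - p) - c = (r : ℂ)⁻¹ * (w - (p + r * (c - p))) by
            field_simp
            ring,
          norm_mul, norm_inv, Complex.norm_real, Real.norm_eq_abs, abs_of_pos hr]
      rw [h1]
      calc r⁻¹ * dist w (p + r * (c - p)) < r⁻¹ * (r * ρ) := mul_lt_mul_of_pos_left hw (inv_pos.2 hr)
        _ = ρ := by field_simp
    · field_simp
      ring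

/-- For `p ∈ ball c ρ` and `r ∈ (0,1]`, the blow-up disc `closedBall (p + r(c-p)) (rρ)` lies in
`closedBall c ρ` (from `Lines/birth.lean`). -/
theorem closedBall_blowup_subset {c p : ℂ} {ρ r : ℝ} (hp : p ∈ Metric.ball c ρ)
    (hr : r ∈ Set.Ioc (0:ℝ) 1) :
    Metric.closedBall (p + r * (c - p)) (r * ρ) ⊆ Metric.closedBall c ρ := by
  intro z hz
  rw [Metric.mem_closedBall] at hz ⊢
  rw [Metric.mem_ball] at hp
  have h1 : dist (p + r * (c - p)) c = (1 - r) * dist p c := by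
    rw [dist_eq_norm, dist_eq_norm,
      show p + (r : ℂ) * (c - p) - c = ((1 - r : ℝ) : ℂ) * (p - c) by push_cast; ring,
      norm_mul, Complex.norm_real, Real.norm_eq_abs, abs_of_nonneg (by linarith [hr.2])]
  calc dist z c ≤ dist z (p + r * (c - p)) + dist (p + r * (c - p)) c := dist_triangle _ _ _
    _ ≤ r * ρ + (1 - r) * dist p c := by rw [h1]; linarith
    _ ≤ r * ρ + (1 - r) * ρ := by
        have : 0 ≤ 1 - r := by linarith [hr.2]
        nlinarith
    _ = ρ := by ring

/-- `A_r` maps `closedBall c ρ` into `closedBall c ρ ⊆ U` (for `p ∈ ball c ρ`, `r ∈ (0,1]`). -/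
theorem mapsTo_blowup_closedBall {c p : ℂ} {ρ r : ℝ} (hp : p ∈ Metric.ball c ρ)
    (hr : r ∈ Set.Ioc (0:ℝ) 1) :
    Set.MapsTo (fun z : ℂ => p + r * (z - p)) (Metric.closedBall c ρ) (Metric.closedBall c ρ) := by
  intro z hz
  apply closedBall_blowup_subset hp hr
  rw [Metric.mem_closedBall] at hz ⊢
  rw [show dist (p + (r : ℂ) * (z - p)) (p + r * (c - p)) = r * dist z c from dist_blowup p z c hr.1.le]
  exact mul_le_mul_of_nonneg_left hz hr.1.le

/-- Multiplication by a positive constant maps `𝓝[>] 0` to itself (from `Lines/birth.lean`). -/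
theorem tendsto_const_mul_nhdsWithin_zero {s : ℝ} (hs : 0 < s) :
    Filter.Tendsto (fun δ : ℝ => s * δ) (nhdsWithin 0 (Set.Ioi 0)) (nhdsWithin 0 (Set.Ioi 0)) := by
  refine tendsto_nhdsWithin_iff.2 ⟨?_, ?_⟩
  · have h : Filter.Tendsto (fun δ : ℝ => s * δ) (nhds 0) (nhds (s * 0)) :=
      (continuous_const.mul continuous_id).tendsto 0
    rw [mul_zero] at h
    exact h.mono_left nhdsWithin_le_nhds
  · exact eventually_mem_nhdsWithin.mono fun δ hδ => mul_pos hs hδ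

/-! ### The geometric core: every rectangle of the crux is image data of ONE marked disc -/

/-- **Blow-up quads are univalent images of the round marked disc.** Under the hypotheses of the
crux, a conformal rectangle `R` presenting the blow-up quad `φ(ball (p + r(c-p)) (rρ))` with marks
`φ(p + r(c + ρe^{iθᵢ} - p))` (`r ∈ (0,1]`) is image data, in the sense of
`IsUniformizing.image_data` / `HasCrossingLimit.of_image_data`, of `markedDisc c ρ θ` under
`h_r = fun z ↦ φ (p + r(z - p))`: `h_r` is holomorphic and injective on the disc, continuous on its
closure, `R.carrier = h_r '' ball c ρ` and `R.pt i = h_r (c + ρe^{iθᵢ})`. -/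
theorem blowup_imageData {U : Set ℂ} {φ : ℂ → ℂ} {c p : ℂ} {ρ : ℝ} {θ : Fin 4 → ℝ}
    (hU : IsOpen U) (hφ : DifferentiableOn ℂ φ U) (hinj : Set.InjOn φ U) (hρ : 0 < ρ)
    (hsub : Metric.closedBall c ρ ⊆ U) (hp : p ∈ Metric.ball c ρ) (hθ : StrictMono θ)
    (hθ' : θ 3 < θ 0 + 2 * Real.pi) {r : ℝ} (hr : r ∈ Set.Ioc (0:ℝ) 1)
    {R : Literature.Probability.RandomPlanarGeometry.ConformalRectangle}
    (hR : R.carrier = φ '' Metric.ball (p + r * (c - p)) (r * ρ) ∧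
      ∀ i, R.pt i = φ (p + r * (c + ρ * Complex.exp (Complex.I * θ i) - p))) :
    DifferentiableOn ℂ (fun z => φ (p + r * (z - p))) (markedDisc c ρ hρ θ hθ hθ').carrier ∧
    Set.InjOn (fun z => φ (p + r * (z - p))) (markedDisc c ρ hρ θ hθ hθ').carrier ∧
    ContinuousOn (fun z => φ (p + r * (z - p))) (closure (markedDisc c ρ hρ θ hθ hθ').carrier) ∧
    R.carrier = (fun z => φ (p + r * (z - p))) '' (markedDisc c ρ hρ θ hθ hθ').carrier ∧
    ∀ i, R.pt i = (fun z => φ (p + r * (z - p))) ((markedDisc c ρ hρ θ hθ hθ').pt i) := by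
  have _ := hU
  rw [markedDisc_carrier]
  -- the affine blow-up map and where it sends the closed disc
  have hA : Set.MapsTo (fun z : ℂ => p + r * (z - p)) (Metric.closedBall c ρ) U :=
    (mapsTo_blowup_closedBall hp hr).mono_right hsub
  have hAo : Set.MapsTo (fun z : ℂ => p + r * (z - p)) (Metric.ball c ρ) U :=
    hA.mono_left Metric.ball_subset_closedBall
  have hAd : Differentiable ℂ (fun z : ℂ => p + r * (z - p)) := by fun_prop
  have hAc : Continuous (fun z : ℂ => p + r * (z - p)) := hAd.continuous
  refine ⟨hφ.comp hAd.differentiableOn hAo, ?_, ?_, ?_, ?_⟩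
  · -- injectivity on the disc: `φ` injective on `U ⊇ A_r(ball)`, `A_r` injective (`r ≠ 0`)
    intro z hz w hw hzw
    have h1 : p + (r : ℂ) * (z - p) = p + r * (w - p) := hinj (hAo hz) (hAo hw) hzw
    have hr' : (r : ℂ) ≠ 0 := Complex.ofReal_ne_zero.2 hr.1.ne'
    have h2 : (r : ℂ) * (z - p) = r * (w - p) := add_left_cancel h1
    have h3 : z - p = w - p := mul_left_cancel₀ hr' h2
    exact sub_left_inj.mp h3
  · -- continuity on the closed disc
    rw [closure_ball c hρ.ne']
    exact hφ.continuousOn.comp hAc.continuousOn hA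
  · -- the carrier
    rw [show (fun z : ℂ => φ (p + r * (z - p))) = φ ∘ (fun z : ℂ => p + r * (z - p)) from rfl,
      Set.image_comp, image_blowup_ball p c ρ hr.1]
    exact hR.1
  · -- the marks
    intro i
    rw [markedDisc_pt, hR.2 i]

/-! ### (1) The crux is a consequence of the summit: `S → X` -/

/-- **`CardyFormulaZ2 → ConformalDilationCovariance`.** The rank-2 crux (= thesis X) of route
`PivotalEnergyLaw` follows from the sub-problem Statement: both rectangles of the crux are univalent
images of one marked disc, so both crossing probabilities converge to `cardyFunction η` for the
cross-ratio `η` of any uniformizing datum of that disc; read along `δ ↦ sδ` and `δ ↦ tδ` the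
difference tends to `F η - F η = 0`. No percolation input beyond the Statement. -/
theorem conformalDilationCovariance_of_cardyFormulaZ2 (hS : _root_.CardyFormulaZ2) :
    PivotalEnergyLaw.ConformalDilationCovariance := by
  intro U φ c p ρ θ hU hφ hinj hρ hsub hp hθ hθ' s t hs ht R R' hR hR'
  obtain ⟨hd, hi, hc, hcar, hpt⟩ := blowup_imageData hU hφ hinj hρ hsub hp hθ hθ' hs hR
  obtain ⟨hd', hi', hc', hcar', hpt'⟩ := blowup_imageData hU hφ hinj hρ hsub hp hθ hθ' ht hR'
  have hQ : (markedDisc c ρ hρ θ hθ hθ').HasCrossingLimit (bondDomainCrossingProb R) cardyFunction :=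
    ConformalRectangle.HasCrossingLimit.of_image_data hd hi hc hcar hpt (hS R)
  have hQ' : (markedDisc c ρ hρ θ hθ hθ').HasCrossingLimit (bondDomainCrossingProb R') cardyFunction :=
    ConformalRectangle.HasCrossingLimit.of_image_data hd' hi' hc' hcar' hpt' (hS R')
  obtain ⟨ψ, x, hψ⟩ := MarkedDomain.exists_isUniformizing_holds (markedDisc c ρ hρ θ hθ hθ')
  have e₁ := (hQ ψ x hψ).comp (tendsto_const_mul_nhdsWithin_zero hs.1)
  have e₂ := (hQ' ψ x hψ).comp (tendsto_const_mul_nhdsWithin_zero ht.1)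
  have key := e₁.sub e₂
  rw [sub_self] at key
  exact key

/-! ### (2) The typed split: `LimitExists → ConfInvTransport → X` -/

/-- **`LimitExists → ConfInvTransport → ConformalDilationCovariance`** — assembly of the split of the
crux into the two cruxes of route `CardyUniqueLimit` (stmt-CriticalPhenomena-0747 `LimitExists`,
stated as the identical decl `PivotalEnergyLaw.LimitExists` of this route, and
stmt-CriticalPhenomena-0794 `CardyUniqueLimit.ConfInvTransport`). Proof: the limit `L` of `R`
(existence) is transported to `R'` (conformal invariance in transport form) along the uniformizing data
`(h_s ∘ ψ, x)` of `R` and `(h_t ∘ ψ, x)` of `R'` obtained from ONE datum `(ψ, x)` of the marked disc —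
the same `x`, so the cross-ratio hypothesis is `rfl`; then subtract along `δ ↦ sδ`, `δ ↦ tδ`. -/
theorem conformalDilationCovariance_of_subs (h₁ : PivotalEnergyLaw.LimitExists)
    (h₂ : CardyUniqueLimit.ConfInvTransport) :
    PivotalEnergyLaw.ConformalDilationCovariance := by
  intro U φ c p ρ θ hU hφ hinj hρ hsub hp hθ hθ' s t hs ht R R' hR hR'
  obtain ⟨hd, hi, hc, hcar, hpt⟩ := blowup_imageData hU hφ hinj hρ hsub hp hθ hθ' hs hR
  obtain ⟨hd', hi', hc', hcar', hpt'⟩ := blowup_imageData hU hφ hinj hρ hsub hp hθ hθ' ht hR'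
  obtain ⟨ψ, x, hψ⟩ := MarkedDomain.exists_isUniformizing_holds (markedDisc c ρ hρ θ hθ hθ')
  have hRu := hψ.image_data hd hi hc hcar hpt
  have hR'u := hψ.image_data hd' hi' hc' hcar' hpt'
  obtain ⟨L, hL⟩ := h₁ R
  have hL' : Filter.Tendsto (bondDomainCrossingProb R') (nhdsWithin 0 (Set.Ioi 0)) (nhds L) :=
    h₂ R R' _ x _ x hRu hR'u rfl L hL
  have key := (hL.comp (tendsto_const_mul_nhdsWithin_zero hs.1)).sub
    (hL'.comp (tendsto_const_mul_nhdsWithin_zero ht.1))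
  rw [sub_self] at key
  exact key

/-- The same assembly with `CardyUniqueLimit.LimitExists` (stmt-0747 as declared in the sister route;
the two `LimitExists` decls are syntactically identical). -/
theorem conformalDilationCovariance_of_cardyUniqueLimit_cruxes (h₁ : CardyUniqueLimit.LimitExists)
    (h₂ : CardyUniqueLimit.ConfInvTransport) :
    PivotalEnergyLaw.ConformalDilationCovariance :=
  conformalDilationCovariance_of_subs h₁ h₂

/-- Consequently the crux lies below the thesis `X_U = CardyUniqueLimitThesis` of route
`CardyUniqueLimit` (existence of a conformally invariant crossing limit, value free):
`CardyUniqueLimitThesis → ConformalDilationCovariance`. -/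
theorem conformalDilationCovariance_of_cardyUniqueLimitThesis
    (hXU : CardyUniqueLimit.CardyUniqueLimitThesis) :
    PivotalEnergyLaw.ConformalDilationCovariance := by
  obtain ⟨f, hf⟩ := hXU
  intro U φ c p ρ θ hU hφ hinj hρ hsub hp hθ hθ' s t hs ht R R' hR hR'
  obtain ⟨hd, hi, hc, hcar, hpt⟩ := blowup_imageData hU hφ hinj hρ hsub hp hθ hθ' hs hR
  obtain ⟨hd', hi', hc', hcar', hpt'⟩ := blowup_imageData hU hφ hinj hρ hsub hp hθ hθ' ht hR'
  have hQ : (markedDisc c ρ hρ θ hθ hθ').HasCrossingLimit (bondDomainCrossingProb R) f :=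
    ConformalRectangle.HasCrossingLimit.of_image_data hd hi hc hcar hpt (hf R)
  have hQ' : (markedDisc c ρ hρ θ hθ hθ').HasCrossingLimit (bondDomainCrossingProb R') f :=
    ConformalRectangle.HasCrossingLimit.of_image_data hd' hi' hc' hcar' hpt' (hf R')
  obtain ⟨ψ, x, hψ⟩ := MarkedDomain.exists_isUniformizing_holds (markedDisc c ρ hρ θ hθ hθ')
  have e₁ := (hQ ψ x hψ).comp (tendsto_const_mul_nhdsWithin_zero hs.1)
  have e₂ := (hQ' ψ x hψ).comp (tendsto_const_mul_nhdsWithin_zero ht.1)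
  have key := e₁.sub e₂
  rw [sub_self] at key
  exact key

end Summit.CriticalPhenomena.CardyFormulaZ2.Cruxes.ConformalDilationCovariance.Redirect

end
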